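import Summits.HodgeConjecture.HodgeConjecture.Theorems.CorCMDominationCMProduct
import Literature.NumberTheory.NumberFields.CMFieldCompositum
import Mathlib.NumberTheory.Cyclotomic.PrimitiveRoots
import Mathlib.RingTheory.Polynomial.Cyclotomic.Roots
import Mathlib.NumberTheory.NumberField.CMField
import HarnessLib

/-!
# COR-CM model layer (model-2), M14 part 3: a common Galois CM field of degree `≥ 6` receiving the
# leaf fields of a coded CM product

For a stage-1 code `v : PicardCM.Var`, the leaf CM codes `c = (E_c ⊂ ℂ, Φ_c)` of its product tree are
finitely many; the subfield of `ℂ` generated by all conjugates of all `E_c` together with the conjugates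
of the cyclotomic field `ℚ(ζ₇)` (CM of degree `6`) is a CM field (Shimura 1998 §18.2 Lemma (ii)–(iii),
the tree's `IntermediateField.isCMField_iSup` / `isCMField_normalClosure`), Galois over `ℚ`
(compositum of normal closures, Mathlib `IntermediateField.normal_iSup`), of degree `≥ 6`, and every
leaf field embeds into it (`LeafEmbeddable`). This supplies the field `F` of stage-1's M14
`Fact_cmDominated` ("composed with a cyclic cubic totally real field if `[F:ℚ] < 6`" — here: with
`ℚ(ζ₇)`). KERNEL; no named fact.

References: G. Shimura, *Abelian Varieties with Complex Multiplication and Modular Functions* (1998),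
§18.2 Lemma (ii)–(iii).
-/

noncomputable section

open IntermediateField NumberField
open Literature.NumberTheory.NumberFields
open Literature.NumberTheory.Automorphic
open Literature.NumberTheory.Automorphic.PicardCM (CMCode)

namespace Summit.HodgeConjecture.CorCM.Domination

/-! ### The leaf codes of a code -/

/-- The CM codes at the leaves of the product tree of a stage-1 code (in order). [folklore] -/
def leafCodes : PicardCM.Var → List CMCode
  | .cm c => [c]
  | .prod v w => leafCodes v ++ leafCodes w
  | .pms _ => []
  | .proj _ => []

/-- `LeafEmbeddable F v` follows from an embedding of every leaf field. [folklore] -/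
theorem leafEmbeddable_of_forall {F : Type} [Field F] :
    ∀ v : PicardCM.Var, (∀ c ∈ leafCodes v, Nonempty (c.E →+* F)) → LeafEmbeddable F v
  | .cm c, h => h c (by simp [leafCodes])
  | .prod v w, h =>
      ⟨leafEmbeddable_of_forall v fun c hc ↦ h c (by simp [leafCodes, hc]),
        leafEmbeddable_of_forall w fun c hc ↦ h c (by simp [leafCodes, hc])⟩
  | .pms _, _ => trivial
  | .proj _, _ => trivial

/-! ### An auxiliary CM field of degree `6`: `ℚ(ζ₇)` -/

/-- `ℚ(ζ₇)` is a CM field (a nontrivial cyclotomic extension of `ℚ`; Mathlib's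
`IsCyclotomicExtension.Rat.isCMField`, the cyclotomic instance supplied by name). [folklore] -/
theorem isCMField_cyclotomic7 : IsCMField (CyclotomicField 7 ℚ) := by
  -- the cyclotomic instance, re-read at the `ℚ`-algebra / ring structures found by instance search
  -- here (the two elaborations differ only by definitionally equal instance paths: `convert … <;> rfl`)
  haveI : IsCyclotomicExtension {7} ℚ (CyclotomicField 7 ℚ) := by
    convert CyclotomicField.isCyclotomicExtension 7 ℚ <;> rfl
  exact IsCyclotomicExtension.Rat.isCMField (CyclotomicField 7 ℚ) (S := {7}) ⟨7, rfl, by norm_num⟩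

/-- `[ℚ(ζ₇) : ℚ] = 6`. [folklore] -/
theorem finrank_cyclotomic7 : Module.finrank ℚ (CyclotomicField 7 ℚ) = 6 := by
  haveI : IsCyclotomicExtension {7} ℚ (CyclotomicField 7 ℚ) := by
    convert CyclotomicField.isCyclotomicExtension 7 ℚ <;> rfl
  rw [IsCyclotomicExtension.finrank (K := ℚ) (n := 7) (CyclotomicField 7 ℚ)
    (Polynomial.cyclotomic.irreducible_rat (by norm_num))]
  decide

/-! ### The common field -/

section Common

variable (v : PicardCM.Var)

/-- The finite family of normal closures inside `ℂ`: of `ℚ(ζ₇)` (index `none`) and of the leaf fields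
of `v` (indices `some i`). [folklore] -/
def closureFamily : Option (Fin (leafCodes v).length) → IntermediateField ℚ ℂ
  | none => normalClosure ℚ (CyclotomicField 7 ℚ) ℂ
  | some i => normalClosure ℚ ((leafCodes v).get i).E ℂ

/-- **The common field** of `v`: the subfield of `ℂ` generated by all conjugates of the leaf fields
and of `ℚ(ζ₇)`. [cite: Shimura1998, §18.2 Lemma (ii)–(iii)] -/
def commonField : IntermediateField ℚ ℂ := ⨆ o, closureFamily v o

/-- Each member of the family is finite over `ℚ` (normal closures of number fields). [folklore] -/
instance closureFamily_finiteDimensional (o : Option (Fin (leafCodes v).length)) :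
    FiniteDimensional ℚ (closureFamily v o) := by
  cases o with
  | none => exact normalClosure.is_finiteDimensional ℚ (CyclotomicField 7 ℚ) ℂ
  | some i => exact normalClosure.is_finiteDimensional ℚ ((leafCodes v).get i).E ℂ

/-- Each member of the family is normal over `ℚ` (a Galois closure inside `ℂ`). [folklore] -/
instance closureFamily_normal (o : Option (Fin (leafCodes v).length)) : Normal ℚ (closureFamily v o) := by
  cases o with
  | none => exact (isGalois_normalClosure_complex (CyclotomicField 7 ℚ)).to_normal
  | some i => exact (isGalois_normalClosure_complex ((leafCodes v).get i).E).to_normal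

/-- The common field is a number field. [folklore] -/
instance numberField_commonField : NumberField (commonField v) :=
  { to_charZero := inferInstance, to_finiteDimensional := IntermediateField.finiteDimensional_iSup_of_finite }

/-- **The common field is a CM field** (Shimura §18.2 Lemma (ii)–(iii): a compositum of Galois closures
of CM fields, one of them — `ℚ(ζ₇)` — CM). [cite: Shimura1998, §18.2 Lemma (ii)–(iii)] -/
instance isCMField_commonField : IsCMField (commonField v) :=
  IntermediateField.isCMField_iSup (K := closureFamily v)
    (fun o ↦ by
      cases o with
      | none => exact isTotallyReal_or_isCMField_normalClosure _ (Or.inr isCMField_cyclotomic7)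
      | some i => exact isTotallyReal_or_isCMField_normalClosure _ (Or.inr inferInstance))
    (i₀ := none) (@isCMField_normalClosure (CyclotomicField 7 ℚ) _ _ isCMField_cyclotomic7)

/-- **The common field is Galois over `ℚ`** (compositum of normal extensions). [folklore] -/
instance isGalois_commonField : IsGalois ℚ (commonField v) := by
  haveI : Normal ℚ (commonField v) :=
    @IntermediateField.normal_iSup ℚ ℂ _ _ _ _ (closureFamily v) (fun o ↦ closureFamily_normal v o)
  exact ⟨⟩

/-- A field homomorphism from `ℚ(ζ₇)` into the common field. [folklore] -/
def cyclotomicToCommon : CyclotomicField 7 ℚ →+* commonField v :=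
  let φ : CyclotomicField 7 ℚ →ₐ[ℚ] ℂ := (Classical.arbitrary (CyclotomicField 7 ℚ →+* ℂ)).toRatAlgHom
  ((IntermediateField.inclusion (le_iSup (closureFamily v) none)).comp
    (φ.codRestrict (normalClosure ℚ (CyclotomicField 7 ℚ) ℂ).toSubalgebra
      fun x ↦ φ.fieldRange_le_normalClosure ⟨x, rfl⟩)).toRingHom

/-- **`[F : ℚ] ≥ 6`** for the common field `F` (it receives `ℚ(ζ₇)`). [folklore] -/
theorem six_le_finrank_commonField : 6 ≤ Module.finrank ℚ (commonField v) := by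
  rw [← finrank_cyclotomic7]
  exact LinearMap.finrank_le_finrank_of_injective
    (f := (cyclotomicToCommon v).toRatAlgHom.toLinearMap) (cyclotomicToCommon v).injective

/-- A field homomorphism from the `i`-th leaf field into the common field. [folklore] -/
def leafToCommon (i : Fin (leafCodes v).length) : ((leafCodes v).get i).E →+* commonField v :=
  let φ : ((leafCodes v).get i).E →ₐ[ℚ] ℂ := (((leafCodes v).get i).E.subtype).toRatAlgHom
  ((IntermediateField.inclusion (le_iSup (closureFamily v) (some i))).comp
    (φ.codRestrict (normalClosure ℚ ((leafCodes v).get i).E ℂ).toSubalgebra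
      fun x ↦ φ.fieldRange_le_normalClosure ⟨x, rfl⟩)).toRingHom

/-- **Every leaf field of `v` embeds into the common field.** [folklore] -/
theorem leafEmbeddable_commonField : LeafEmbeddable (commonField v) v := by
  refine leafEmbeddable_of_forall v fun c hc ↦ ?_
  obtain ⟨i, hi⟩ := List.get_of_mem hc
  subst hi
  exact ⟨leafToCommon v i⟩

end Common

/-- **A common Galois CM field of degree `≥ 6` receiving the leaf fields** (the field `F` of stage-1
M14 `Fact_cmDominated` for the coded model `v`). [cite: Shimura1998, §18.2 Lemma (ii)–(iii)] -/
theorem exists_commonField (v : PicardCM.Var) :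
    ∃ (F : Type) (_ : Field F) (_ : NumberField F) (_ : IsCMField F),
      IsGalois ℚ F ∧ 6 ≤ Module.finrank ℚ F ∧ LeafEmbeddable F v :=
  ⟨commonField v, inferInstance, inferInstance, inferInstance, isGalois_commonField v,
    six_le_finrank_commonField v, leafEmbeddable_commonField v⟩

/-! ### M14 assembled at the tree level (binders: `Shimura1998_Thm3_isogenousPower`,
`Shimura1998_Thm2_Cor`; for arbitrary CM abelian varieties also `hDom`) -/

/-- **M14 for a CM-flagged stage-1 code** (the codes universe `universeOf`): the interpretation of `v`
is dominated by `∏_j A_{(F,Θ_j)}` over a Galois CM field `F` of degree `≥ 6` (the common field of `v`).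
[cite: Shimura1998, §6.2 Theorem 3, §6.1 Corollary of Theorem 2, §18.2 Lemma (ii)–(iii)] -/
theorem coded_cmDominated (hU : PicardCM.BallQuotientUniformisedDatum) (h₃ : PicardCM.CMAbelianVarietyRealised)
    (hd : Literature.AlgebraicGeometry.ComplexMultiplication.Shimura1998_Thm3_isogenousPower)
    (hcor : Literature.AlgebraicGeometry.ComplexMultiplication.Shimura1998_Thm2_Cor)
    (v : PicardCM.Var) (hv : PicardCM.Var.IsCMAbelianVariety h₃ v) :
    ∃ (F : Type) (_ : Field F) (_ : NumberField F) (_ : IsCMField F),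
      IsGalois ℚ F ∧ 6 ≤ Module.finrank ℚ F ∧
        ∃ (n : ℕ) (Θ : Fin (n + 1) → Literature.AlgebraicGeometry.Motives.CMType F),
          IsDominatedBy (PicardCM.Var.scheme hU h₃ v) (cmProdAV F h₃ n Θ).X :=
  ⟨commonField v, inferInstance, inferInstance, inferInstance, isGalois_commonField v,
    six_le_finrank_commonField v,
    coded_isDominatedBy hU h₃ hd hcor v hv (leafEmbeddable_commonField v)⟩

/-- **M14 for an arbitrary complex abelian variety of CM type** (the iso-complete universe `universe₂`):
`A` is dominated, as an abelian variety, by `∏_j A_{(F,Θ_j)}` over a Galois CM field `F` of degree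
`≥ 6`, granted CM domination by realised codes up to isogeny (`hDom`, the binder of the tree's
`Milne1999.forall_cmHodgeHypothesisAt_of_codesHC`, discharged there by `Milne1999.hDom_of_hSimple`).
[cite: Shimura1998, §5.1 Props. 1, 3, 4, §6.1 Corollary of Theorem 2, §6.2 Theorem 3, §18.2 Lemma (ii)–(iii)] -/
theorem cmDominated_of_isOfCMType (hU : PicardCM.BallQuotientUniformisedDatum)
    (h₃ : PicardCM.CMAbelianVarietyRealised)
    (hd : Literature.AlgebraicGeometry.ComplexMultiplication.Shimura1998_Thm3_isogenousPower)
    (hcor : Literature.AlgebraicGeometry.ComplexMultiplication.Shimura1998_Thm2_Cor)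
    (hDom : ∀ A : Literature.AlgebraicGeometry.Motives.AbelianVariety ℂ,
      Literature.AlgebraicGeometry.Motives.IsSmoothProjective A.dim A.X →
      Literature.AlgebraicGeometry.Milne1999.IsOfCMType A →
      ∃ (v : PicardCM.Var) (B : Literature.AlgebraicGeometry.Motives.AbelianVariety ℂ),
        PicardCM.Var.IsCMAbelianVariety h₃ v ∧ B.X = PicardCM.Var.scheme hU h₃ v ∧
          Literature.AlgebraicGeometry.Motives.AbelianVariety.IsIsogenous A B)
    (A : Literature.AlgebraicGeometry.Motives.AbelianVariety ℂ)
    (hA : Literature.AlgebraicGeometry.Motives.IsSmoothProjective A.dim A.X)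
    (hCM : Literature.AlgebraicGeometry.Milne1999.IsOfCMType A) :
    ∃ (F : Type) (_ : Field F) (_ : NumberField F) (_ : IsCMField F),
      IsGalois ℚ F ∧ 6 ≤ Module.finrank ℚ F ∧
        ∃ (n : ℕ) (Θ : Fin (n + 1) → Literature.AlgebraicGeometry.Motives.CMType F),
          AVDominatedBy A (cmProdAV F h₃ n Θ) := by
  obtain ⟨v, -, hF⟩ := avDominatedBy_cmProd_of_isOfCMType hU h₃ hd hcor hDom A hA hCM
  exact ⟨commonField v, inferInstance, inferInstance, inferInstance, isGalois_commonField v,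
    six_le_finrank_commonField v, hF (commonField v) (leafEmbeddable_commonField v)⟩

end Summit.HodgeConjecture.CorCM.Domination

end
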